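import Mathlib
import Summits.KontsevichZagierPeriods.Zeta5Search.FloorInequalityWProof
import HarnessLib

/-!
# ζ(5) search — the floor inequality `law_W ≤ T_x(3)` holds for EVERY multipole class (no pole-order hypothesis)

Cell `pub-zeta5` (HONEST FRAMING: systematic search; no irrationality claim unless certified), TRACK «DENOM-LAW» D1 prover seat
(denom-prover-d1 g11, `HOME/denom-law/prover-d1/ATTEMPT-11.md` §1).  The tree's `lawW_le_classBound_multi` (`FloorInequalityWProof`,
gen-2 g7's (T1-iii) Steps 2–3) proves `law_W = refund_W + a_p − N_p ≤ T_x(3) = 3 + E_x + [palindromic ∧ 3 + E_x odd]` for a multipole class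
WITH A POLE OF ORDER ≥ 3 (used there only to get two further met blocks).  Here the hypothesis is removed:

* `lawW_le_classBound_three` — in the polytope with `p ≥ 5`, EVERY class with at least two poles satisfies `law_W ≤ T_x(3)`.

PROOF.  With a pole of order `≥ 3`: the tree lemma.  Without: every class point off the even centre has depth `≤ 3`
(`blockCount_le_three_of_noOrder3`), so a class point lying in two distinct further blocks (beyond the two largest `B_{j₁} ⊇ B_{j₂}`) is the
even centre (`four_le_blockCount`); hence if some further block `B_{k*}` is met twice, every other further block holds only the even centre
(and then the even-centre count `X ≥ 1` pays the single deficit of the charging of `FloorInequalityWProof`), and in the residual case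
`K = {k*}` tightness forces the two-point class `(−2,−2)` — palindromic with `3 + E_x = −1` odd, so the palindrome bonus pays.
This is the combinatorial input of `MixedPairBoundLevelProof` (the mixed-pair bound-level inequality).  Integer bookkeeping on the seven
nested blocks (`p ≥ 1`, the polytope); nothing about irrationality.
-/

noncomputable section

open Finset

namespace Summit.KontsevichZagierPeriods.Zeta5Search.ClusterValuation

open Summit.KontsevichZagierPeriods.Zeta5Search.DualSeries (InBox)
open Summit.KontsevichZagierPeriods.Zeta5Search.CasoratianValuation
  (InPolytope pairFloors refund refundW topPartners CasoratianValuationLaw)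

/-! ### (L2) `law_W ≤ T_x(3)` for every multipole class with `E_x ≤ −3` -/

/-- A position lying in four distinct blocks has depth `≥ 4`. -/
theorem four_le_blockCount (b : ℕ → ℤ) {s j₁ j₂ j₃ j₄ : ℕ} (h₁ : j₁ < 7) (h₂ : j₂ < 7) (h₃ : j₃ < 7) (h₄ : j₄ < 7)
    (h12 : j₁ ≠ j₂) (h13 : j₁ ≠ j₃) (h14 : j₁ ≠ j₄) (h23 : j₂ ≠ j₃) (h24 : j₂ ≠ j₄) (h34 : j₃ ≠ j₄)
    (hs₁ : s ∈ blk b j₁) (hs₂ : s ∈ blk b j₂) (hs₃ : s ∈ blk b j₃) (hs₄ : s ∈ blk b j₄) : 4 ≤ blockCount b s := by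
  rw [blockCount_eq]
  have hsub : insert j₁ (insert j₂ (insert j₃ {j₄})) ⊆ (range 7).filter fun j => s ∈ blk b j := by
    intro k hk
    simp only [mem_insert, mem_singleton] at hk
    rw [mem_filter, mem_range]
    rcases hk with rfl | rfl | rfl | rfl
    · exact ⟨h₁, hs₁⟩
    · exact ⟨h₂, hs₂⟩
    · exact ⟨h₃, hs₃⟩
    · exact ⟨h₄, hs₄⟩
  have hcard : (insert j₁ (insert j₂ (insert j₃ ({j₄} : Finset ℕ)))).card = 4 := by
    rw [card_insert_of_notMem, card_insert_of_notMem, card_pair h34]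
    · simp only [mem_insert, mem_singleton, not_or]; exact ⟨h23, h24⟩
    · simp only [mem_insert, mem_singleton, not_or]; exact ⟨h12, h13, h14⟩
  have := card_le_card hsub
  omega

/-- Without a pole of order `≥ 3`, a class point off the even centre has depth `≤ 3`. -/
theorem blockCount_le_three_of_noOrder3 (b : ℕ → ℤ) {p x s : ℕ} (hno : ¬ HasPoleOfOrder b p x 3)
    (hs : s ∈ classSet b p x) (hc : ¬ 2 * (s : ℤ) = b 0) : blockCount b s ≤ 3 := by
  unfold HasPoleOfOrder at hno
  push Not at hno
  have h := hno s hs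
  unfold netExp at h
  rw [if_neg hc] at h
  push_cast at h
  omega

/-- **(L2) = (T1-iii) without the pole-order hypothesis**: in the polytope with `p ≥ 5`, EVERY multipole class satisfies
`law_W ≤ T_x(3)` (the tree's `lawW_le_classBound_multi` asks for a pole of order `≥ 3`). -/
theorem lawW_le_classBound_three (b : ℕ → ℤ) {p x : ℕ} (hb : InPolytope b) (hp5 : 5 ≤ p)
    (hmulti : 2 ≤ classPoleCount b p x) : lawW b p ≤ classBound b p x 3 := by
  by_cases hpole : HasPoleOfOrder b p x 3
  · exact lawW_le_classBound_multi b hb hp5 hmulti hpole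
  -- set-up as in `lawW_le_classBound_multi`
  have hbox : InBox b := hb.1
  have hp : 0 < p := by omega
  obtain ⟨j₁, hj₁, j₂, hj₂, hmin₁, hmin₂⟩ := exists_two_largest b
  have hj₁7 := mem_range.1 hj₁
  have hj₂7 := mem_range.1 (mem_erase.1 hj₂).2
  have hj₂1 : j₂ ≠ j₁ := (mem_erase.1 hj₂).1
  set C : ℕ := (classSet b p x).card with hCdef
  set R₁ := (range 7).erase j₁ with hR₁
  set R₂ := R₁.erase j₂ with hR₂
  have hR₂sub : R₂ ⊆ range 7 := (erase_subset _ _).trans (erase_subset _ _)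
  obtain ⟨q₁, hq₁, q₂, hq₂, hqne⟩ := one_lt_card.1 (by unfold classPoleCount at hmulti; omega :
    1 < ((classSet b p x).filter fun s => netExp b s < 0).card)
  rw [mem_filter] at hq₁ hq₂
  have hn2 : 2 ≤ nB b p x j₂ := by
    unfold nB
    refine one_lt_card.2 ⟨q₁, mem_filter.2 ⟨hq₁.1, ?_⟩, q₂, mem_filter.2 ⟨hq₂.1, ?_⟩, hqne⟩
    · exact mem_second_of_blockCount b hbox hj₂ hmin₂ (two_le_blockCount_of_pole b hq₁.2)
    · exact mem_second_of_blockCount b hbox hj₂ hmin₂ (two_le_blockCount_of_pole b hq₂.2)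
  have hn1 : nB b p x j₂ ≤ nB b p x j₁ := nB_mono b hbox p x hj₁7 hj₂7 (hmin₁ j₂ (mem_erase.1 hj₂).2)
  have hCge : nB b p x j₁ ≤ C := card_filter_le _ _
  have hn1Z : (2 : ℤ) ≤ nB b p x j₁ := by exact_mod_cast le_trans hn2 hn1
  have hn2Z : (2 : ℤ) ≤ nB b p x j₂ := by exact_mod_cast hn2
  have hn12Z : (nB b p x j₂ : ℤ) ≤ nB b p x j₁ := by exact_mod_cast hn1
  have hCZ : (nB b p x j₁ : ℤ) ≤ C := by exact_mod_cast hCge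
  have hF12 := floorFact1 (x := x) b hb hp hj₁7 hj₂7 (by omega) (by omega)
  have hN12 : 1 ≤ pairTerm b p j₁ j₂ := by omega
  set K := R₂.filter (fun k => 1 ≤ nB b p x k) with hK
  have hKsub : K ⊆ R₂ := filter_subset _ _
  have hKmem : ∀ k ∈ K, k < 7 ∧ k ≠ j₁ ∧ k ≠ j₂ ∧ 1 ≤ nB b p x k := by
    intro k hk
    obtain ⟨hk2, hk1⟩ := mem_filter.1 hk
    obtain ⟨hkj2, hkR1⟩ := mem_erase.1 hk2
    obtain ⟨hkj1, hk7⟩ := mem_erase.1 hkR1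
    exact ⟨mem_range.1 hk7, hkj1, hkj2, hk1⟩
  have hF : ∀ k ∈ K, 1 ≤ pairTerm b p j₁ k ∧ 1 ≤ pairTerm b p j₂ k ∧
      (nB b p x k : ℤ) ≤ pairTerm b p j₂ k + 1 ∧ nB b p x k ≤ nB b p x j₂ := by
    intro k hk
    obtain ⟨hk7, hkj1, hkj2, hk1⟩ := hKmem k hk
    have hkR1 : k ∈ R₁ := mem_erase.2 ⟨hkj1, mem_range.2 hk7⟩
    have hF1a := floorFact1 (x := x) b hb hp hj₁7 hk7 (by omega) hk1
    have hF1b := floorFact1 (x := x) b hb hp hj₂7 hk7 (by omega) hk1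
    have hF2 := floorFact2 (x := x) b hb hp hj₂7 hk7 (hmin₂ k hkR1) hk1
    have hmono := nB_mono b hbox p x hj₂7 hk7 (hmin₂ k hkR1)
    have h1k : (1 : ℤ) ≤ nB b p x k := by exact_mod_cast hk1
    exact ⟨by omega, by omega, by linarith, hmono⟩
  -- the blocks of `K` sit inside `B_{j₂} ⊆ B_{j₁}`
  have hKblk : ∀ k ∈ K, ∀ s, s ∈ blk b k → s ∈ blk b j₁ ∧ s ∈ blk b j₂ := by
    intro k hk s hsk
    obtain ⟨hk7, hkj1, -, -⟩ := hKmem k hk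
    have hkR1 : k ∈ R₁ := mem_erase.2 ⟨hkj1, mem_range.2 hk7⟩
    exact ⟨blk_subset_blk b hbox hj₁7 hk7 (hmin₁ k (mem_range.2 hk7)) hsk,
      blk_subset_blk b hbox hj₂7 hk7 (hmin₂ k hkR1) hsk⟩
  -- a class point in two distinct blocks of `K` is the even centre
  have hcentre : ∀ k ∈ K, ∀ k' ∈ K, k ≠ k' → ∀ s ∈ classSet b p x, s ∈ blk b k → s ∈ blk b k' → 2 * (s : ℤ) = b 0 := by
    intro k hk k' hk' hkk' s hs hsk hsk'
    obtain ⟨hk7, hkj1, hkj2, -⟩ := hKmem k hk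
    obtain ⟨hk'7, hk'j1, hk'j2, -⟩ := hKmem k' hk'
    obtain ⟨hs1, hs2⟩ := hKblk k hk s hsk
    have h4 := four_le_blockCount b hj₁7 hj₂7 hk7 hk'7 hj₂1.symm (Ne.symm hkj1) (Ne.symm hk'j1) (Ne.symm hkj2)
      (Ne.symm hk'j2) hkk' hs1 hs2 hsk hsk'
    by_contra hc
    have := blockCount_le_three_of_noOrder3 b hpole hs hc
    omega
  -- KEY STRUCTURAL FACT: if a block of `K` is met twice, every other block of `K` holds only the even centre
  have hA : ∀ k ∈ K, 2 ≤ nB b p x k → ∀ k' ∈ K, k' ≠ k → ∀ w ∈ classSet b p x, w ∈ blk b k' → 2 * (w : ℤ) = b 0 := by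
    intro k hk hk2 k' hk' hk'k w hw hwk'
    obtain ⟨hk7, -, -, -⟩ := hKmem k hk
    obtain ⟨hk'7, -, -, -⟩ := hKmem k' hk'
    obtain ⟨u, hu, v, hv, huv⟩ := one_lt_card.1 (by unfold nB at hk2; exact hk2 :
      1 < ((classSet b p x).filter fun s => s ∈ blk b k).card)
    rw [mem_filter] at hu hv
    rcases le_total (b (k + 1)) (b (k' + 1)) with hle | hle
    · -- `B_{k'} ⊆ B_k`: `w` lies in both
      exact hcentre k hk k' hk' hk'k.symm w hw (blk_subset_blk b hbox hk7 hk'7 hle hwk') hwk'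
    · -- `B_k ⊆ B_{k'}`: `u, v` lie in both, so both are the even centre — impossible
      exfalso
      have hu' := hcentre k hk k' hk' hk'k.symm u hu.1 hu.2 (blk_subset_blk b hbox hk'7 hk7 hle hu.2)
      have hv' := hcentre k hk k' hk' hk'k.symm v hv.1 hv.2 (blk_subset_blk b hbox hk'7 hk7 hle hv.2)
      exact huv (by exact_mod_cast (show (u : ℤ) = v by linarith))
  -- hence at most one block of `K` is met twice
  have hA1 : ∀ k ∈ K, 2 ≤ nB b p x k → ∀ k' ∈ K, k' ≠ k → nB b p x k' = 1 := by
    intro k hk hk2 k' hk' hk'k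
    have h1 := (hKmem k' hk').2.2.2
    have hle : nB b p x k' ≤ 1 := by
      unfold nB
      refine card_le_one.2 fun u hu v hv => ?_
      rw [mem_filter] at hu hv
      have hu' := hA k hk hk2 k' hk' hk'k u hu.1 hu.2
      have hv' := hA k hk hk2 k' hk' hk'k v hv.1 hv.2
      exact_mod_cast (show (u : ℤ) = v by linarith)
    omega
  -- `Σ_{R₂} nB = Σ_K nB`
  have hsumK : ∑ k ∈ R₂, (nB b p x k : ℤ) = ∑ k ∈ K, (nB b p x k : ℤ) := by
    rw [← sum_filter_add_sum_filter_not R₂ (fun k => 1 ≤ nB b p x k)]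
    have : ∑ k ∈ R₂.filter (fun k => ¬ 1 ≤ nB b p x k), (nB b p x k : ℤ) = 0 :=
      sum_eq_zero fun k hk => by
        have := (mem_filter.1 hk).2
        have h0 : nB b p x k = 0 := by push Not at this; exact Nat.lt_one_iff.mp this
        simp only [h0, Nat.cast_zero]
    rw [this, add_zero]
  -- the exact class exponent
  have hEx := classExp_eq_card_sub b p x
  rw [← add_sum_erase _ _ hj₁, ← add_sum_erase _ _ hj₂, hsumK] at hEx
  have hX1 : (0 : ℤ) ≤ (((classSet b p x).filter fun s : ℕ => 2 * (s : ℤ) = b 0).card : ℤ) := Nat.cast_nonneg _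
  have hX2 : (0 : ℤ) ≤ (if ¬ (2 : ℤ) ∣ b 0 ∧ CentreIn b p x then 1 else 0) := by split_ifs <;> norm_num
  -- the pair floors: `N_p = star₁ + star₂ + pairSum R₂`
  have hP1 := pairSum_erase b p (mem_range.2 hj₁7 : j₁ ∈ range 7)
  have hP2 := pairSum_erase b p (hj₂ : j₂ ∈ R₁)
  rw [pairSum_range, ← hR₁] at hP1
  -- the charging of the top partners, with `T = insert j₂ K`
  have hj₂K : j₂ ∉ K := fun h => (hKmem j₂ h).2.2.1 rfl
  have hT : insert j₂ K ⊆ R₁ := insert_subset hj₂ (hKsub.trans (erase_subset _ _))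
  have hT1 : ∀ k ∈ insert j₂ K, 1 ≤ pairTerm b p j₁ k := by
    intro k hk
    rcases mem_insert.1 hk with rfl | hk
    · exact hN12
    · exact (hF k hk).1
  have ha := topPartners_add_le_star b hb hp hj₁ hmin₁ hT hT1
  rw [sum_insert hj₂K] at ha
  have hstar2 : ∑ k ∈ K, pairTerm b p j₂ k ≤ ∑ k ∈ R₂, pairTerm b p j₂ k :=
    sum_le_sum_of_subset_of_nonneg hKsub fun k hk _ => pairTerm_nonneg b hb p hj₂7 (mem_range.1 (hR₂sub hk))
  have hrest : pairSum b p K ≤ pairSum b p R₂ := pairSum_mono b hb p hKsub hR₂sub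
  have hr : refundW b p ≤ 1 := min_le_left _ _
  -- the bound
  unfold classBound
  rw [if_pos hmulti]
  set palb := (if IsPalindromic (classConfig b p x) ∧ Odd (((3 : ℕ) : ℤ) + classExp b p x) then (1 : ℤ) else 0)
    with hpalb
  have hpalb0 : 0 ≤ palb := by rw [hpalb]; split_ifs <;> norm_num
  unfold lawW
  -- reduce to the key inequality
  suffices hkey : 0 ≤ (∑ k ∈ K, (pairTerm b p j₁ k - 1 + pairTerm b p j₂ k - nB b p x k)) + pairSum b p K + palb +
      (((C : ℤ) - nB b p x j₁) + (pairTerm b p j₁ j₂ + 1 - nB b p x j₂) +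
        (((classSet b p x).filter fun s : ℕ => 2 * (s : ℤ) = b 0).card : ℤ) +
        (if ¬ (2 : ℤ) ∣ b 0 ∧ CentreIn b p x then 1 else 0)) by
    have e1 : ∑ k ∈ K, (pairTerm b p j₁ k - 1 + pairTerm b p j₂ k - nB b p x k) =
        ∑ k ∈ K, (pairTerm b p j₁ k - 1) + ∑ k ∈ K, pairTerm b p j₂ k - ∑ k ∈ K, (nB b p x k : ℤ) := by
      rw [← sum_add_distrib, ← sum_sub_distrib]
    rw [e1] at hkey
    push_cast at hEx ⊢
    linarith
  -- per-block terms: no deficit for a block met once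
  have hper1 : ∀ k ∈ K, nB b p x k = 1 → (0 : ℤ) ≤ pairTerm b p j₁ k - 1 + pairTerm b p j₂ k - nB b p x k := by
    intro k hk h1
    obtain ⟨h1', h2, -, -⟩ := hF k hk
    rw [h1]; push_cast; linarith
  have hslack1 : (0 : ℤ) ≤ (C : ℤ) - nB b p x j₁ := by linarith
  have hslack2 : (0 : ℤ) ≤ pairTerm b p j₁ j₂ + 1 - nB b p x j₂ := by linarith
  have hPK := pairSum_nonneg b hb p (S := K) (hKsub.trans hR₂sub)
  by_cases hK'0 : ∀ k ∈ K, nB b p x k = 1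
  · -- no block met twice besides `j₁, j₂`: no deficit at all
    have hsum0 : (0 : ℤ) ≤ ∑ k ∈ K, (pairTerm b p j₁ k - 1 + pairTerm b p j₂ k - nB b p x k) :=
      sum_nonneg fun k hk => hper1 k hk (hK'0 k hk)
    linarith
  -- a block `kS ∈ K` met at least twice; every other block of `K` is met exactly once
  push Not at hK'0
  obtain ⟨kS, hkSK, hkS1⟩ := hK'0
  have hkS2 : 2 ≤ nB b p x kS := by have := (hKmem kS hkSK).2.2.2; omega
  have hothers : ∀ k ∈ K.erase kS, nB b p x k = 1 := fun k hk =>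
    hA1 kS hkSK hkS2 k (mem_of_mem_erase hk) (ne_of_mem_erase hk)
  have hsplit : ∑ k ∈ K, (pairTerm b p j₁ k - 1 + pairTerm b p j₂ k - nB b p x k) =
      (pairTerm b p j₁ kS - 1 + pairTerm b p j₂ kS - nB b p x kS) +
        ∑ k ∈ K.erase kS, (pairTerm b p j₁ k - 1 + pairTerm b p j₂ k - nB b p x k) :=
    (add_sum_erase _ _ hkSK).symm
  have hsumE : (0 : ℤ) ≤ ∑ k ∈ K.erase kS, (pairTerm b p j₁ k - 1 + pairTerm b p j₂ k - nB b p x k) :=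
    sum_nonneg fun k hk => hper1 k (mem_of_mem_erase hk) (hothers k hk)
  obtain ⟨hkS7, hkSj1, hkSj2, -⟩ := hKmem kS hkSK
  obtain ⟨hN1S, hN2S, hF2S, hmonoS⟩ := hF kS hkSK
  have hF1S := floorFact1 (x := x) b hb hp hj₁7 hkS7 (by omega) (by omega)
  have h2SZ : (2 : ℤ) ≤ nB b p x kS := by exact_mod_cast hkS2
  have hmonoSZ : (nB b p x kS : ℤ) ≤ nB b p x j₂ := by exact_mod_cast hmonoS
  by_cases hK1 : ∃ k' ∈ K, k' ≠ kS
  · -- a second further block holds the even centre: `X ≥ 1` pays for the one deficit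
    obtain ⟨k', hk'K, hk'S⟩ := hK1
    have h1 := (hKmem k' hk'K).2.2.2
    obtain ⟨w, hw⟩ := card_pos.1 (by unfold nB at h1; exact h1 : 0 < ((classSet b p x).filter fun s => s ∈ blk b k').card)
    rw [mem_filter] at hw
    have hwc := hA kS hkSK hkS2 k' hk'K hk'S w hw.1 hw.2
    have hX1' : (1 : ℤ) ≤ (((classSet b p x).filter fun s : ℕ => 2 * (s : ℤ) = b 0).card : ℤ) := by
      have : 0 < ((classSet b p x).filter fun s : ℕ => 2 * (s : ℤ) = b 0).card := card_pos.2 ⟨w, mem_filter.2 ⟨hw.1, hwc⟩⟩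
      exact_mod_cast this
    rw [hsplit]
    linarith
  -- THE RESIDUAL CASE `K = {kS}`
  push Not at hK1
  have hKeq : K = {kS} := eq_singleton_iff_unique_mem.2 ⟨hkSK, hK1⟩
  have hPK0 : pairSum b p K = 0 := by
    rw [hKeq]; unfold pairSum; simp
  have hKe : K.erase kS = ∅ := by rw [hKeq, erase_singleton]
  by_contra hneg
  push Not at hneg
  rw [hsplit, hKe, sum_empty] at hneg
  -- every slack vanishes
  have hT_n1 : (nB b p x j₁ : ℤ) = 2 := by linarith
  have hT_C : (C : ℤ) = 2 := by linarith
  have hT_n2 : (nB b p x j₂ : ℤ) = 2 := by linarith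
  have hT_nS : (nB b p x kS : ℤ) = 2 := by linarith
  have hT_X1 : (((classSet b p x).filter fun s : ℕ => 2 * (s : ℤ) = b 0).card : ℤ) = 0 := by linarith
  have hT_X2 : (if ¬ (2 : ℤ) ∣ b 0 ∧ CentreIn b p x then (1 : ℤ) else 0) = 0 := by linarith
  have hT_pal : palb = 0 := by linarith
  -- the class: two points, each of depth exactly 3
  have hall : ∀ q' ∈ classSet b p x, q' ∈ blk b j₁ ∧ q' ∈ blk b j₂ ∧ q' ∈ blk b kS := fun q' hq' =>
    ⟨mem_blk_of_nB_eq_card b (by exact_mod_cast hT_n1.trans hT_C.symm) q' hq',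
     mem_blk_of_nB_eq_card b (by exact_mod_cast hT_n2.trans hT_C.symm) q' hq',
     mem_blk_of_nB_eq_card b (by exact_mod_cast hT_nS.trans hT_C.symm) q' hq'⟩
  have hnone : ∀ k ∈ R₂, k ∉ K → ∀ q' ∈ classSet b p x, q' ∉ blk b k := by
    intro k hk hkK
    have : nB b p x k = 0 := by
      by_contra hne
      exact hkK (mem_filter.2 ⟨hk, Nat.one_le_iff_ne_zero.2 hne⟩)
    exact not_mem_blk_of_nB_eq_zero b this
  have hnoEven : ∀ q' ∈ classSet b p x, ¬ 2 * (q' : ℤ) = b 0 := by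
    intro q' hq' hc
    have hmem : q' ∈ (classSet b p x).filter fun s : ℕ => 2 * (s : ℤ) = b 0 := mem_filter.2 ⟨hq', hc⟩
    have : 0 < ((classSet b p x).filter fun s : ℕ => 2 * (s : ℤ) = b 0).card := card_pos.2 ⟨q', hmem⟩
    omega
  have hnoOdd : ¬ (¬ (2 : ℤ) ∣ b 0 ∧ CentreIn b p x) := by
    intro h; rw [if_pos h] at hT_X2; exact one_ne_zero hT_X2
  have hnet : ∀ q' ∈ classSet b p x, netExp b q' = -2 := by
    intro q' hq'
    obtain ⟨h1, h2, h3⟩ := hall q' hq'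
    have hset : (range 7).filter (fun j => q' ∈ blk b j) = insert j₁ (insert j₂ {kS}) := by
      ext k
      simp only [mem_filter, mem_insert, mem_singleton, mem_range]
      constructor
      · rintro ⟨hk7, hqk⟩
        by_contra hne
        push Not at hne
        have hkR₂ : k ∈ R₂ := mem_erase.2 ⟨hne.2.1, mem_erase.2 ⟨hne.1, mem_range.2 hk7⟩⟩
        have hkK : k ∉ K := by rw [hKeq]; simp [hne.2.2]
        exact hnone k hkR₂ hkK q' hq' hqk
      · rintro (rfl | rfl | rfl)
        · exact ⟨hj₁7, h1⟩
        · exact ⟨hj₂7, h2⟩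
        · exact ⟨hkS7, h3⟩
    unfold netExp
    rw [blockCount_eq, hset, card_insert_of_notMem, card_pair (Ne.symm hkSj2), if_neg (hnoEven q' hq')]
    · norm_num
    · simp only [mem_insert, mem_singleton, not_or]; exact ⟨hj₂1.symm, Ne.symm hkSj1⟩
  -- the class exponent is `−4`
  have hE4 : classExp b p x = -4 := by
    have hsum2 : ∑ k ∈ K, (nB b p x k : ℤ) = 2 := by rw [hKeq, sum_singleton]; linarith
    rw [hsum2] at hEx
    linarith
  -- the configuration is a palindromic pair
  obtain ⟨u, v, huv, hcls⟩ := card_eq_two.1 (show (classSet b p x).card = 2 by exact_mod_cast hT_C)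
  have hconf : classConfig b p x = {((((2 * u : ℕ) : ℤ)), (-2 : ℤ)), ((((2 * v : ℕ) : ℤ)), (-2 : ℤ))} := by
    unfold classConfig
    rw [if_neg hnoOdd, union_empty]
    have hfilt : (classSet b p x).filter (fun s => netExp b s ≠ 0) = classSet b p x :=
      filter_true_of_mem fun s hs => by rw [hnet s hs]; norm_num
    rw [hfilt, hcls, image_insert, image_singleton, hnet u (by rw [hcls]; simp), hnet v (by rw [hcls]; simp)]
  have hpal : IsPalindromic (classConfig b p x) := by rw [hconf]; exact isPalindromic_pair _ _ _
  have hodd : Odd (((3 : ℕ) : ℤ) + classExp b p x) := ⟨-1, by rw [hE4]; norm_num⟩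
  rw [hpalb, if_pos ⟨hpal, hodd⟩] at hT_pal
  exact one_ne_zero hT_pal

end Summit.KontsevichZagierPeriods.Zeta5Search.ClusterValuation

end
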